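import Summits.AtomisticToContinuum.FouriersLaw.Theorems.VanishingNoiseTransferNoiseLocalityStubResponseDensityNoisyAux5
import Summits.AtomisticToContinuum.FouriersLaw.Theorems.VanishingNoiseTransferNoiseLocalityStubResponseDensityNoisyAux6

/-!
# The `L²(μ_T)`-Liouville theorem for the equilibrium Langevin generator of the pinned chain
(helpers for stub `stub_responseDensityNoisy`)

Helper file `--supports stmt-AtomisticToContinuum-11975` (crux `NoiseLocality`, route
`VanishingNoiseTransfer`, line `relative-flip-energy-transfer`, stub 1b `stub_responseDensityNoisy`).

**Theorem (`ae_eq_zero_of_weak_generator`, registered helper `helper_responseDensityNoisyWeakLiouville`;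
the input (U₀) of `of_apriori_of_liouville`).** For the pinned anharmonic chain (`ω₂, β, γ, T > 0`,
`lam ≥ 0`, `N ≥ 2`) and the Gibbs measure `μ_T`: a mean-zero `k ∈ L²(μ_T)` with
`∫ (L_{T,T} F) k dμ_T = 0` for every `F ∈ C_c^∞` vanishes a.e. (`L²`-ergodicity of `μ_T` for the
equilibrium dynamics, in generator form).

Proof, entirely in `H = L²(μ_T)`. (a) CLOSURE: by the dense range of `(1 - L)C_c^∞`
(`exists_testFunction_resolvent_approx`) pick test functions `F_n` with `F_n - LF_n → k`; the lower
bound `‖F‖ ≤ ‖F - LF‖` (`resolvent_lower_bound`) makes `F_n` Cauchy, `F_n → x`, `‖x‖ ≤ ‖k‖`, and the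
weak equation gives `⟨x, k⟩ = ‖k‖²`, so `x = k`: `F_n → k` AND `LF_n → 0`. (b) SEMIGROUP (previous file):
`‖P_tF_n - F_n‖ ≤ t‖LF_n‖`, `‖P_tF_n - P_tF_m‖ ≤ ‖F_n - F_m‖`, `‖P_tF_n - μ_T(F_n)‖ ≤ √K B_n e^{-ct}`.
(c) Hence `P_tF_m → k` (`m → ∞`, `t` fixed), `‖k - P_tF_n‖ ≤ ‖k - F_n‖`, and letting `t → ∞`,
`‖k - μ_T(F_n)·1‖ ≤ ‖k - F_n‖ → 0`; since `μ_T(F_n) → μ_T(k) = 0`, `k = 0`.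

Consequence (`of_apriori`, registered helper `helper_responseDensityNoisyOfApriori`): **the stub
`stub_responseDensityNoisy` for `N ≥ 2` holds as soon as (A) the a priori `L²(μ_T)` linear-response
bound of the flip steady family holds** — the uniqueness side is now completely proved. No definitions.
-/

noncomputable section

open MeasureTheory ProbabilityTheory Filter Topology Set
open scoped ContDiff NNReal InnerProductSpace

namespace Summit.AtomisticToContinuum.FouriersLaw.Theorems.NoiseLocality.StubResponseDensityNoisy

open Literature.MathematicalPhysics.KineticTheory.HeatConduction
open Summit.AtomisticToContinuum.FouriersLaw.Theorems.OddSectorIrreversibility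

variable {ω₂ lam β γ : ℝ} {N : ℕ} {T : ℝ}

/-- `‖k‖_{L²(μ)} = √∫ k² dμ` for the class of an `L²` function. -/
theorem norm_toLp_eq_sqrt {μ : Measure (PhaseSpace N)} {k : PhaseSpace N → ℝ} (hk : MemLp k 2 μ) :
    ‖hk.toLp k‖ = Real.sqrt (∫ x, k x ^ 2 ∂μ) := by
  have h : ‖hk.toLp k‖ ^ 2 = ∫ x, k x ^ 2 ∂μ := by
    rw [← real_inner_self_eq_norm_sq, inner_toLp_toLp_eq_integral hk hk]
    exact integral_congr_ae (Eventually.of_forall fun x => by simp only; ring)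
  rw [← h, Real.sqrt_sq (norm_nonneg _)]

/-- **The `L²(μ_T)`-Liouville theorem for the equilibrium generator.** See the module docstring. -/
theorem ae_eq_zero_of_weak_generator (hω : 0 < ω₂) (hl : 0 ≤ lam) (hβ : 0 < β) (hγ : 0 < γ)
    (hN : 2 ≤ N) (hT : 0 < T) {k : PhaseSpace N → ℝ}
    (hk : MemLp k 2 ((pinnedChain ω₂ lam β γ).gibbsMeasure N T))
    (hk0 : ∫ x, k x ∂((pinnedChain ω₂ lam β γ).gibbsMeasure N T) = 0)
    (hweak : ∀ F : PhaseSpace N → ℝ, ContDiff ℝ ∞ F → HasCompactSupport F →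
      ∫ x, (pinnedChain ω₂ lam β γ).generator N T T F x * k x
        ∂((pinnedChain ω₂ lam β γ).gibbsMeasure N T) = 0) :
    k =ᵐ[(pinnedChain ω₂ lam β γ).gibbsMeasure N T] 0 := by
  classical
  set P := pinnedChain ω₂ lam β γ with hP
  set π := P.gibbsMeasure N T with hπ_def
  haveI hprob : IsProbabilityMeasure π := pinnedChain_isProbabilityMeasure_gibbsMeasure hω hl hβ.le γ N hT
  have hN0 : 0 < N := by omega
  have hU1 := pinnedChain_contDiff_U ω₂ lam β γ (n := 1)
  have hV1 := pinnedChain_contDiff_V ω₂ lam β γ (n := 1)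
  -- (a) approximants `F n - L F n → k`
  have happrox : ∀ n : ℕ, ∃ F : PhaseSpace N → ℝ, ContDiff ℝ ∞ F ∧ HasCompactSupport F ∧
      ∫ x, (k x - (1 * F x - P.generator N T T F x)) ^ 2 ∂π ≤ (1 / ((n : ℝ) + 1)) ^ 2 := fun n =>
    exists_testFunction_resolvent_approx hω hl hβ.le hγ hN hT one_pos hk (by positivity)
  choose F hFs hFc hFa using happrox
  have hF2 : ∀ n, ContDiff ℝ 2 (F n) := fun n => (hFs n).of_le (by norm_cast)
  have hFm : ∀ n, MemLp (F n) 2 π := fun n =>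
    memLp_of_continuous_hasCompactSupport (hFs n).continuous (hFc n) π 2
  have hLm : ∀ n, MemLp (P.generator N T T (F n)) 2 π := fun n =>
    memLp_of_continuous_hasCompactSupport (P.continuous_generator hU1 hV1 N T T (hF2 n))
      (P.hasCompactSupport_generator N T T (hF2 n) (hFc n)) π 2
  have hRm : ∀ n, MemLp (fun x => 1 * F n x - P.generator N T T (F n) x) 2 π := fun n =>
    ((hFm n).const_mul 1).sub (hLm n)
  set φ : ℕ → Lp ℝ 2 π := fun n => (hFm n).toLp (F n) with hφ_def
  set ψ : ℕ → Lp ℝ 2 π := fun n => (hRm n).toLp _ with hψ_def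
  set Λ : ℕ → Lp ℝ 2 π := fun n => (hLm n).toLp _ with hΛ_def
  set κv : Lp ℝ 2 π := hk.toLp k with hκv_def
  -- `ψ n → κv`
  have hψ : Tendsto ψ atTop (𝓝 κv) := by
    rw [tendsto_iff_norm_sub_tendsto_zero]
    have hbd : ∀ n, ‖ψ n - κv‖ ≤ 1 / ((n : ℝ) + 1) := by
      intro n
      have hsub : MemLp (fun x => (1 * F n x - P.generator N T T (F n) x) - k x) 2 π := (hRm n).sub hk
      have e : ψ n - κv = hsub.toLp _ := (MemLp.toLp_sub (hRm n) hk).symm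
      rw [e, norm_toLp_eq_sqrt]
      calc Real.sqrt (∫ x, ((1 * F n x - P.generator N T T (F n) x) - k x) ^ 2 ∂π)
          = Real.sqrt (∫ x, (k x - (1 * F n x - P.generator N T T (F n) x)) ^ 2 ∂π) := by
            congr 1
            exact integral_congr_ae (Eventually.of_forall fun x => by ring)
        _ ≤ Real.sqrt ((1 / ((n : ℝ) + 1)) ^ 2) := Real.sqrt_le_sqrt (hFa n)
        _ = 1 / ((n : ℝ) + 1) := Real.sqrt_sq (by positivity)
    exact squeeze_zero (fun n => norm_nonneg _) hbd tendsto_one_div_add_atTop_nhds_zero_nat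
  -- lower bound ⇒ `φ` Cauchy
  have hlow : ∀ n m, ‖φ n - φ m‖ ≤ ‖ψ n - ψ m‖ := by
    intro n m
    have hFnm : ContDiff ℝ ∞ (fun x => F n x - F m x) := (hFs n).sub (hFs m)
    have hFnmc : HasCompactSupport (fun x => F n x - F m x) := (hFc n).sub (hFc m)
    have hsubm : MemLp (fun x => F n x - F m x) 2 π := (hFm n).sub (hFm m)
    have hRsub : MemLp (fun x => 1 * (F n x - F m x) -
        P.generator N T T (fun y => F n y - F m y) x) 2 π := by
      refine ((hRm n).sub (hRm m)).ae_eq (Eventually.of_forall fun x => ?_)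
      simp only [Pi.sub_apply]
      rw [generator_sub P N T T (hF2 n) (hF2 m) x]
      ring
    have h := resolvent_lower_bound hω hl hβ.le hγ hT 1 hFnm hFnmc hsubm hRsub
    have e1 : hsubm.toLp _ = φ n - φ m := MemLp.toLp_sub (hFm n) (hFm m)
    have e2 : hRsub.toLp _ = ψ n - ψ m := by
      rw [hψ_def, ← MemLp.toLp_sub]
      refine MemLp.toLp_congr _ _ (Eventually.of_forall fun x => ?_)
      simp only [Pi.sub_apply]
      rw [generator_sub P N T T (hF2 n) (hF2 m) x]
      ring
    rw [e1, e2, one_mul] at h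
    exact h
  have hφc : CauchySeq φ := by
    have hψc : CauchySeq ψ := hψ.cauchySeq
    rw [Metric.cauchySeq_iff] at hψc ⊢
    intro e he
    obtain ⟨M, hM⟩ := hψc e he
    refine ⟨M, fun n hn m hm => ?_⟩
    have h2 := hM n hn m hm
    rw [dist_eq_norm] at h2 ⊢
    exact (hlow n m).trans_lt h2
  obtain ⟨xv, hx⟩ := cauchySeq_tendsto_of_complete hφc
  -- `Λ n = φ n - ψ n` and the weak equation `⟨Λ n, κv⟩ = 0`
  have hΛ : ∀ n, Λ n = φ n - ψ n := by
    intro n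
    rw [hΛ_def, hφ_def, hψ_def, ← MemLp.toLp_sub]
    exact MemLp.toLp_congr _ _ (Eventually.of_forall fun x => by
      simp only [Pi.sub_apply]
      ring)
  have hw : ∀ n, ⟪φ n, κv⟫_ℝ - ⟪ψ n, κv⟫_ℝ = 0 := by
    intro n
    rw [← inner_sub_left, ← hΛ n, hΛ_def, hκv_def, inner_toLp_toLp_eq_integral]
    exact hweak (F n) (hFs n) (hFc n)
  have hlim_eq : ⟪xv, κv⟫_ℝ - ‖κv‖ ^ 2 = 0 := by
    have h1 : Tendsto (fun n => ⟪φ n, κv⟫_ℝ - ⟪ψ n, κv⟫_ℝ) atTop (𝓝 (⟪xv, κv⟫_ℝ - ⟪κv, κv⟫_ℝ)) :=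
      (hx.inner tendsto_const_nhds).sub (hψ.inner tendsto_const_nhds)
    rw [real_inner_self_eq_norm_sq] at h1
    have h2 : Tendsto (fun n => ⟪φ n, κv⟫_ℝ - ⟪ψ n, κv⟫_ℝ) atTop (𝓝 0) := by
      simp only [hw]
      exact tendsto_const_nhds
    exact tendsto_nhds_unique h1 h2
  have hxbound : ‖xv‖ ≤ ‖κv‖ :=
    le_of_tendsto_of_tendsto' hx.norm hψ.norm fun n => by
      have h := resolvent_lower_bound hω hl hβ.le hγ hT 1 (hFs n) (hFc n) (hFm n) (hRm n)
      rwa [one_mul] at h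
  have hxk : xv = κv := by
    have h : ‖xv - κv‖ ^ 2 ≤ 0 := by
      rw [norm_sub_sq_real]
      nlinarith [hlim_eq, hxbound, norm_nonneg xv, norm_nonneg κv]
    have h0 : ‖xv - κv‖ = 0 := by nlinarith [norm_nonneg (xv - κv)]
    exact sub_eq_zero.1 (norm_eq_zero.1 h0)
  have hφ : Tendsto φ atTop (𝓝 κv) := hxk ▸ hx
  have hΛ0 : Tendsto Λ atTop (𝓝 0) := by
    have h := hφ.sub hψ
    rw [sub_self] at h
    refine h.congr fun n => (hΛ n).symm
  -- (b) the semigroup vectors `p t n = P_t F_n`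
  have hBex : ∀ n, ∃ B : ℝ, 0 ≤ B ∧ ∀ y, ‖F n y‖ ≤ B := fun n => by
    obtain ⟨C, hC⟩ := (hFs n).continuous.bounded_above_of_compact_support (hFc n)
    exact ⟨max C 0, le_max_right _ _, fun y => (hC y).trans (le_max_left _ _)⟩
  choose B hB0 hB using hBex
  have hB' : ∀ n y, |F n y| ≤ B n := fun n y => (Real.norm_eq_abs _).symm.le.trans (hB n y)
  have hPm : ∀ (t : ℝ≥0) n, MemLp (fun z => ∫ y, F n y ∂(P.transitionKernel N T T t z)) 2 π :=
    fun t n => memLp_act_of_bounded hω hl hβ hγ (hFs n).continuous (hB n) t π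
  set p : ℝ≥0 → ℕ → Lp ℝ 2 π := fun t n => (hPm t n).toLp _ with hp_def
  -- (b1) Dynkin: `‖p t n - φ n‖ ≤ t ‖Λ n‖`
  have hb1 : ∀ (t : ℝ≥0) n, ‖p t n - φ n‖ ≤ (t : ℝ) * ‖Λ n‖ := by
    intro t n
    have e : p t n - φ n = ((hPm t n).sub (hFm n)).toLp _ := (MemLp.toLp_sub _ _).symm
    rw [e, norm_toLp_eq_sqrt, hΛ_def, norm_toLp_eq_sqrt]
    have h := integral_sq_act_sub_le hω hl hβ hγ hN0 hT (hFs n) (hFc n) t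
    calc Real.sqrt (∫ x, ((fun z => ∫ y, F n y ∂(P.transitionKernel N T T t z)) - F n) x ^ 2 ∂π)
        ≤ Real.sqrt ((t : ℝ) ^ 2 * ∫ z, (P.generator N T T (F n) z) ^ 2 ∂π) := Real.sqrt_le_sqrt h
      _ = (t : ℝ) * Real.sqrt (∫ z, (P.generator N T T (F n) z) ^ 2 ∂π) := by
          rw [Real.sqrt_mul (sq_nonneg _), Real.sqrt_sq t.coe_nonneg]
  -- (b2) contraction: `‖p t n - p t m‖ ≤ ‖φ n - φ m‖`
  have hb2 : ∀ (t : ℝ≥0) n m, ‖p t n - p t m‖ ≤ ‖φ n - φ m‖ := by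
    intro t n m
    have e1 : p t n - p t m = ((hPm t n).sub (hPm t m)).toLp _ := (MemLp.toLp_sub _ _).symm
    have e2 : φ n - φ m = ((hFm n).sub (hFm m)).toLp _ := (MemLp.toLp_sub _ _).symm
    rw [e1, e2, norm_toLp_eq_sqrt, norm_toLp_eq_sqrt]
    exact Real.sqrt_le_sqrt (integral_sq_act_sub_act_le hω hl hβ hγ hN0 hT (hFs n) (hFc n) (hFs m) (hFc m) t)
  -- (b3) mixing: `‖p t n - μ_T(F n)·1‖² ≤ K B_n² e^{-2ct}`
  obtain ⟨K, c, hc, hmix⟩ := exists_integral_sq_act_sub_mean_le hω hl hβ hγ hN0 hT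
  have h1m : MemLp (fun _ : PhaseSpace N => (1 : ℝ)) 2 π := memLp_const 1
  set one : Lp ℝ 2 π := h1m.toLp _ with hone_def
  set cn : ℕ → ℝ := fun n => ∫ x, F n x ∂π with hcn_def
  have hb3 : ∀ (t : ℝ≥0) n, ‖p t n - cn n • one‖ ^ 2 ≤ K * B n ^ 2 * Real.exp (-(2 * c) * (t : ℝ)) := by
    intro t n
    have e : p t n - cn n • one = ((hPm t n).sub (h1m.const_mul (cn n))).toLp _ := by
      rw [hp_def, hone_def, ← MemLp.toLp_const_smul, ← MemLp.toLp_sub]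
      exact MemLp.toLp_congr _ _ (Eventually.of_forall fun x => by
        simp only [Pi.sub_apply, Pi.smul_apply, smul_eq_mul])
    rw [e, norm_toLp_eq_sqrt, Real.sq_sqrt (integral_nonneg fun z => sq_nonneg _)]
    have h := hmix (F n) (hFs n).continuous (B n) (hB0 n) (hB' n) t
    refine le_trans (le_of_eq (integral_congr_ae (Eventually.of_forall fun z => ?_))) h
    simp only [Pi.sub_apply, mul_one, hcn_def]
    rfl
  -- (c) `p t m → κv` for fixed `t`, hence `‖κv - p t n‖ ≤ ‖κv - φ n‖`
  have hpconv : ∀ t : ℝ≥0, Tendsto (fun m => p t m) atTop (𝓝 κv) := by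
    intro t
    rw [tendsto_iff_norm_sub_tendsto_zero]
    have h1 : Tendsto (fun m => (t : ℝ) * ‖Λ m‖) atTop (𝓝 0) := by
      have h := (tendsto_norm_zero.comp hΛ0).const_mul (t : ℝ)
      rw [mul_zero] at h
      exact h
    have h2 : Tendsto (fun m => ‖φ m - κv‖) atTop (𝓝 0) := tendsto_iff_norm_sub_tendsto_zero.1 hφ
    have h12 := h1.add h2
    rw [add_zero] at h12
    refine squeeze_zero (fun m => norm_nonneg _) (fun m => ?_) h12
    exact (norm_sub_le_norm_sub_add_norm_sub (p t m) (φ m) κv).trans (add_le_add (hb1 t m) le_rfl)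
  have hc1 : ∀ (t : ℝ≥0) n, ‖κv - p t n‖ ≤ ‖κv - φ n‖ := fun t n =>
    le_of_tendsto_of_tendsto' ((hpconv t).sub tendsto_const_nhds).norm
      ((hφ.sub tendsto_const_nhds).norm) fun m => hb2 t m n
  -- (d) `t → ∞`: `‖κv - cn n • one‖ ≤ ‖κv - φ n‖`
  have hd : ∀ n, ‖κv - cn n • one‖ ≤ ‖κv - φ n‖ := by
    intro n
    have he : Tendsto (fun t : ℝ≥0 => Real.exp (-(2 * c) * (t : ℝ))) atTop (𝓝 0) :=
      Real.tendsto_exp_atBot.comp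
        ((tendsto_id.const_mul_atTop_of_neg (by linarith : -(2 * c) < 0)).comp
          (NNReal.tendsto_coe_atTop.2 tendsto_id))
    have hs : Tendsto (fun t : ℝ≥0 => Real.sqrt (K * B n ^ 2 * Real.exp (-(2 * c) * (t : ℝ)))) atTop
        (𝓝 0) := by
      have h := (Real.continuous_sqrt.tendsto _).comp (he.const_mul (K * B n ^ 2))
      rwa [mul_zero, Function.comp_def, Real.sqrt_zero] at h
    have hlim : Tendsto (fun t : ℝ≥0 => ‖κv - φ n‖ +
        Real.sqrt (K * B n ^ 2 * Real.exp (-(2 * c) * (t : ℝ)))) atTop (𝓝 (‖κv - φ n‖ + 0)) :=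
      tendsto_const_nhds.add hs
    rw [add_zero] at hlim
    refine ge_of_tendsto' hlim fun t => ?_
    calc ‖κv - cn n • one‖ ≤ ‖κv - p t n‖ + ‖p t n - cn n • one‖ :=
          norm_sub_le_norm_sub_add_norm_sub _ _ _
      _ ≤ ‖κv - φ n‖ + Real.sqrt (K * B n ^ 2 * Real.exp (-(2 * c) * (t : ℝ))) := by
          refine add_le_add (hc1 t n) ?_
          have h := Real.abs_le_sqrt (hb3 t n)
          rwa [abs_of_nonneg (norm_nonneg _)] at h
  -- (e) conclusion
  have hcn : Tendsto cn atTop (𝓝 0) := by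
    have h := hφ.inner (𝕜 := ℝ) (tendsto_const_nhds (x := one))
    have e1 : ∀ n, ⟪φ n, one⟫_ℝ = cn n := fun n => by
      rw [hφ_def, hone_def, inner_toLp_toLp_eq_integral]
      simp only [mul_one, hcn_def]
    have e2 : ⟪κv, one⟫_ℝ = 0 := by
      rw [hκv_def, hone_def, inner_toLp_toLp_eq_integral]
      simpa only [mul_one] using hk0
    simp only [e1, e2] at h
    exact h
  have hconv1 : Tendsto (fun n => cn n • one) atTop (𝓝 κv) := by
    rw [tendsto_iff_norm_sub_tendsto_zero]
    have h : Tendsto (fun n => ‖κv - φ n‖) atTop (𝓝 0) := by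
      have h := tendsto_iff_norm_sub_tendsto_zero.1 hφ
      refine h.congr fun n => ?_
      exact norm_sub_rev _ _
    refine squeeze_zero (fun n => norm_nonneg _) (fun n => ?_) h
    rw [norm_sub_rev]
    exact hd n
  have hconv2 : Tendsto (fun n => cn n • one) atTop (𝓝 0) := by
    have h := hcn.smul_const one
    rwa [zero_smul] at h
  have hκ0 : κv = 0 := tendsto_nhds_unique hconv1 hconv2
  exact hk.coeFn_toLp.symm.trans (Lp.eq_zero_iff_ae_eq_zero.1 hκ0)

/-! ### The stub for `N ≥ 2` from the a priori bound (A) alone -/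

/-- **The stub `stub_responseDensityNoisy` for `N ≥ 2`, `ε > 0`, from the single analytic input (A).**
For the pinned chain (`ω₂, β, γ, T > 0`, `lam ≥ 0`) and the flip steady family `μ` at rate `ε > 0`
(steady at positive temperatures, unique at `(T, T)`), the a priori `L²(μ_T)` linear-response bound
(A) — for small `δ ≠ 0`, `dμ_δ/dμ_T = 1 + δ k_δ` with `∫ k_δ² dμ_T ≤ C` — implies the existence of the
`L²(μ_T)` response density with the `HasDerivAt` clauses of the stub: compactness
(`of_apriori_of_unique`), the noise dropping out of the uniqueness equation
(`integral_generator_mul_eq_zero_of_weak`) and the `L²(μ_T)`-Liouville theorem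
(`ae_eq_zero_of_weak_generator`). -/
theorem of_apriori (hω : 0 < ω₂) (hl : 0 ≤ lam) (hβ : 0 < β) (hγ : 0 < γ) (hN : 2 ≤ N) (hT : 0 < T)
    {ε : ℝ} (hε : 0 < ε) (μ : ℝ → ℝ → Measure (PhaseSpace N))
    (hμ : ∀ T_L T_R : ℝ, 0 < T_L → 0 < T_R →
      (pinnedChain ω₂ lam β γ).IsFlipSteadyState N T_L T_R ε (μ T_L T_R) ∧
        ∀ ν : Measure (PhaseSpace N),
          (pinnedChain ω₂ lam β γ).IsFlipSteadyState N T_L T_R ε ν → ν = μ T_L T_R)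
    (hA : ∃ C : ℝ, ∀ᶠ δ in 𝓝[≠] (0 : ℝ), ∃ k : PhaseSpace N → ℝ,
      MemLp k 2 ((pinnedChain ω₂ lam β γ).gibbsMeasure N T) ∧
        ∫ x, k x ^ 2 ∂((pinnedChain ω₂ lam β γ).gibbsMeasure N T) ≤ C ∧
        ∀ F : PhaseSpace N → ℝ, MemLp F 2 ((pinnedChain ω₂ lam β γ).gibbsMeasure N T) →
          Integrable F (μ (T + δ / 2) (T - δ / 2)) ∧
            ∫ x, F x ∂(μ (T + δ / 2) (T - δ / 2)) =
              ∫ x, F x ∂((pinnedChain ω₂ lam β γ).gibbsMeasure N T) +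
                δ * ∫ x, F x * k x ∂((pinnedChain ω₂ lam β γ).gibbsMeasure N T)) :
    ∃ U : PhaseSpace N → ℝ,
      MemLp U 2 ((pinnedChain ω₂ lam β γ).gibbsMeasure N T) ∧
        (∀ g : PhaseSpace N → ℝ, ContDiff ℝ ((⊤ : ℕ∞) : WithTop ℕ∞) g → HasCompactSupport g →
            HasDerivAt (fun δ : ℝ => ∫ x, g x ∂(μ (T + δ / 2) (T - δ / 2)))
              (∫ x, g x * U x ∂((pinnedChain ω₂ lam β γ).gibbsMeasure N T)) 0) ∧
        HasDerivAt (fun δ : ℝ => (pinnedChain ω₂ lam β γ).totalCurrent (μ (T + δ / 2) (T - δ / 2)))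
          (∑ i : Fin N, ∫ x, (pinnedChain ω₂ lam β γ).bondCurrent N i x * U x
            ∂((pinnedChain ω₂ lam β γ).gibbsMeasure N T)) 0 :=
  of_apriori_of_liouville hω hl hβ.le hγ hN hT hε μ hμ hA fun _ hk hk0 hkw =>
    ae_eq_zero_of_weak_generator hω hl hβ hγ hN hT hk hk0 hkw

/-! ### Registered helper sub-goals (stub form, one line each) -/

/-- Registered helper sub-goal `helper_responseDensityNoisyWeakLiouville` of stub `stub_responseDensityNoisy`
(= `ae_eq_zero_of_weak_generator` in stub form): the `L²(μ_T)`-Liouville theorem (U₀). -/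
theorem helper_responseDensityNoisyWeakLiouville : ∀ ω₂ lam β γ : ℝ, 0 < ω₂ → 0 ≤ lam → 0 < β → 0 < γ → ∀ (N : ℕ), 2 ≤ N → ∀ (T : ℝ), 0 < T → ∀ k : Literature.MathematicalPhysics.KineticTheory.HeatConduction.PhaseSpace N → ℝ, MeasureTheory.MemLp k 2 ((Literature.MathematicalPhysics.KineticTheory.HeatConduction.pinnedChain ω₂ lam β γ).gibbsMeasure N T) → ∫ x, k x ∂((Literature.MathematicalPhysics.KineticTheory.HeatConduction.pinnedChain ω₂ lam β γ).gibbsMeasure N T) = 0 → (∀ F : Literature.MathematicalPhysics.KineticTheory.HeatConduction.PhaseSpace N → ℝ, ContDiff ℝ ((⊤ : ℕ∞) : WithTop ℕ∞) F → HasCompactSupport F → ∫ x, (Literature.MathematicalPhysics.KineticTheory.HeatConduction.pinnedChain ω₂ lam β γ).generator N T T F x * k x ∂((Literature.MathematicalPhysics.KineticTheory.HeatConduction.pinnedChain ω₂ lam β γ).gibbsMeasure N T) = 0) → Filter.EventuallyEq (MeasureTheory.ae ((Literature.MathematicalPhysics.KineticTheory.HeatConduction.pinnedChain ω₂ lam β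 γ).gibbsMeasure N T)) k 0 :=
  fun _ _ _ _ hω hl hβ hγ _ hN _ hT _ hk hk0 hweak => ae_eq_zero_of_weak_generator hω hl hβ hγ hN hT hk hk0 hweak

/-- Registered helper sub-goal `helper_responseDensityNoisyOfApriori` of stub `stub_responseDensityNoisy`
(= `of_apriori` in stub form): the stub for `N ≥ 2`, `ε > 0` from the a priori `L²(μ_T)` linear-response
bound (A) alone. -/
theorem helper_responseDensityNoisyOfApriori : ∀ ω₂ lam β γ : ℝ, 0 < ω₂ → 0 ≤ lam → 0 < β → 0 < γ → ∀ (N : ℕ), 2 ≤ N → ∀ (T : ℝ), 0 < T → ∀ (ε : ℝ), 0 < ε → ∀ (μ : ℝ → ℝ → MeasureTheory.Measure (Literature.MathematicalPhysics.KineticTheory.HeatConduction.PhaseSpace N)), (∀ T_L T_R : ℝ, 0 < T_L → 0 < T_R → (Literature.MathematicalPhysics.KineticTheory.HeatConduction.pinnedChain ω₂ lam β γ).IsFlipSteadyState N T_L T_R ε (μ T_L T_R) ∧ ∀ ν : MeasureTheory.Measure (Literature.MathematicalPhysics.KineticTheory.HeatConduction.PhaseSpace N), (Literature.MathematicalPhysics.KineticTheory.HeatConduction.pinnedChain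 ω₂ lam β γ).IsFlipSteadyState N T_L T_R ε ν → ν = μ T_L T_R) → (∃ C : ℝ, ∀ᶠ δ in nhdsWithin (0 : ℝ) {(0 : ℝ)}ᶜ, ∃ k : Literature.MathematicalPhysics.KineticTheory.HeatConduction.PhaseSpace N → ℝ, MeasureTheory.MemLp k 2 ((Literature.MathematicalPhysics.KineticTheory.HeatConduction.pinnedChain ω₂ lam β γ).gibbsMeasure N T) ∧ ∫ x, k x ^ 2 ∂((Literature.MathematicalPhysics.KineticTheory.HeatConduction.pinnedChain ω₂ lam β γ).gibbsMeasure N T) ≤ C ∧ ∀ F : Literature.MathematicalPhysics.KineticTheory.HeatConduction.PhaseSpace N → ℝ, MeasureTheory.MemLp F 2 ((Literature.MathematicalPhysics.KineticTheory.HeatConduction.pinnedChain ω₂ lam β γ).gibbsMeasure N T) → MeasureTheory.Integrable F (μ (T + δ / 2) (T - δ / 2)) ∧ ∫ x, F x ∂(μ (T + δ / 2) (T - δ / 2)) = ∫ x, F x ∂((Literature.MathematicalPhysics.KineticTheory.HeatConduction.pinnedChain ω₂ lam β γ).gibbsMeasure N T) + δ * ∫ x, F x * k x ∂((Literature.MathematicalPhysics.KineticTheory.HeatConduction.pinnedChain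 ω₂ lam β γ).gibbsMeasure N T)) → ∃ U : Literature.MathematicalPhysics.KineticTheory.HeatConduction.PhaseSpace N → ℝ, MeasureTheory.MemLp U 2 ((Literature.MathematicalPhysics.KineticTheory.HeatConduction.pinnedChain ω₂ lam β γ).gibbsMeasure N T) ∧ (∀ g : Literature.MathematicalPhysics.KineticTheory.HeatConduction.PhaseSpace N → ℝ, ContDiff ℝ ((⊤ : ℕ∞) : WithTop ℕ∞) g → HasCompactSupport g → HasDerivAt (fun δ : ℝ => ∫ x, g x ∂(μ (T + δ / 2) (T - δ / 2))) (∫ x, g x * U x ∂((Literature.MathematicalPhysics.KineticTheory.HeatConduction.pinnedChain ω₂ lam β γ).gibbsMeasure N T)) 0) ∧ HasDerivAt (fun δ : ℝ => (Literature.MathematicalPhysics.KineticTheory.HeatConduction.pinnedChain ω₂ lam β γ).totalCurrent (μ (T + δ / 2) (T - δ / 2))) (∑ i : Fin N, ∫ x, (Literature.MathematicalPhysics.KineticTheory.HeatConduction.pinnedChain ω₂ lam β γ).bondCurrent N i x * U x ∂((Literature.MathematicalPhysics.KineticTheory.HeatConduction.pinnedChain ω₂ lam β γ).gibbsMeasure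 N T)) 0 :=
  fun _ _ _ _ hω hl hβ hγ _ hN _ hT _ hε μ hμ hA => of_apriori hω hl hβ hγ hN hT hε μ hμ hA

end Summit.AtomisticToContinuum.FouriersLaw.Theorems.NoiseLocality.StubResponseDensityNoisy

end
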